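import Mathlib
import Summits.CriticalPhenomena.CardyFormulaZ2.Theorems.CardySelfRefinementGradientComparabilityStubDcZeroHalfGeSumPivotal
import Literature.Probability.Percolation.RussoFormula
import HarnessLib

/-!
# Non-degeneracy gives a pivotal edge: `0 < Σ_{e ∈ W} P_{1/2}(e pivotal for Aloc)²`

Crux `stmt-CriticalPhenomena-10269`
(`Summit.CriticalPhenomena.CardyFormulaZ2.Theses.CardySelfRefinement.GradientComparability`),
line **Sketch**, stub `stub_exists_pivotal_of_nondegenerate` (D0): the technical positivity
hypothesis `0 < Σ_{e ∈ W} P(e pivotal)²` of the Talagrand–Rossignol sharp-threshold inequality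
(`SharpThreshold.sharpThreshold_event`) for the localised joint crossing event `Aloc m F η`
under bond percolation on `ℤ²` at `p = ½`, derived from the non-degeneracy
`0 < P(Aloc) (1 - P(Aloc))`.  Vocabulary (`window`, `Aloc`, `A`, `edgesNear`, …) from
`CardySelfRefinementDefs`; `isUpperSet_Aloc` from the imported landed stub file.

## Mathematics

Let `μ = P_{1/2}` and `t = μ(Aloc)`.  From `0 < t (1 - t)` we get `0 < t < 1`, so there are
configurations `ω₀ ∈ Aloc` and `ω₁ ∉ Aloc`.  The event `Aloc = {ω | ω ∩ window ∈ A}` is decided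
by the finite window `W`, so `D := ω₀ ∩ W ∈ Aloc` and `S := ω₁ ∩ W ∉ Aloc`; `Aloc` is increasing
(`isUpperSet_Aloc`), so `S ∪ D ∈ Aloc`.  Inserting the edges of `D` into `S` one at a time
(induction on the finite set `D`), membership in `Aloc` flips at some step: there are a
configuration `T` and an edge `e ∈ D ⊆ W`, `e ∉ T`, with `T ∉ Aloc` and `T ∪ {e} ∈ Aloc`
(`exists_insert_mem_of_union_mem`, a discrete intermediate value step).  Every configuration `ω`
agreeing with `T` on `W ∖ {e}` has `(ω ∪ {e}) ∩ W = (T ∪ {e}) ∩ W` and `(ω ∖ {e}) ∩ W = T ∩ W`,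
so `e` is pivotal for `Aloc` at `ω`: the pivotality event contains the cylinder `[T]_{W ∖ {e}}`
(`localCylinder_subset_setOf_isPivotal`), whose `P_{1/2}`-probability is `(½)^{|W| - 1} > 0`
because the window consists of lattice edges (`Russo.setBernoulli_real_localCylinder`).  Hence
`P_{1/2}(e pivotal) > 0` for this `e ∈ W`, and the sum of squares is positive.
-/

noncomputable section

namespace Summit.CriticalPhenomena.CardyFormulaZ2.Theorems.CardySelfRefinement

open scoped Topology
open Filter Set MeasureTheory
open Literature.Probability.LatticeModels Literature.Probability.Percolation
open Literature.Probability.Percolation.QuadCrossing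
open Summit.CriticalPhenomena.CardyFormulaZ2.Theses.CardySelfRefinement

/-! ## A discrete intermediate value step -/

/-- **Discrete intermediate value step.**  If `S ∉ B` but `S ∪ D ∈ B` for a finite set `D`, then,
inserting the elements of `D` into `S` one at a time, membership in `B` flips somewhere: there
are `T ⊆ S ∪ D` and `e ∈ D`, `e ∉ T`, with `T ∉ B` and `insert e T ∈ B`. -/
theorem exists_insert_mem_of_union_mem {ι : Type*} [DecidableEq ι] {B : Set (Set ι)}
    (D : Finset ι) :
    ∀ S : Set ι, S ∉ B → S ∪ ↑D ∈ B →
      ∃ T : Set ι, ∃ e ∈ D, T ⊆ S ∪ ↑D ∧ e ∉ T ∧ T ∉ B ∧ insert e T ∈ B := by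
  induction D using Finset.induction_on with
  | empty =>
    intro S hS hSD
    rw [Finset.coe_empty, Set.union_empty] at hSD
    exact absurd hSD hS
  | insert a D _ ih =>
    intro S hS hSD
    by_cases haS : insert a S ∈ B
    · refine ⟨S, a, Finset.mem_insert_self a D, Set.subset_union_left, ?_, hS, haS⟩
      intro haS'
      rw [Set.insert_eq_of_mem haS'] at haS
      exact hS haS
    · have h' : insert a S ∪ ↑D ∈ B := by
        rwa [Set.insert_union, ← Set.union_insert, ← Finset.coe_insert]
      obtain ⟨T, e, heD, hT, heT, hTB, heTB⟩ := ih (insert a S) haS h'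
      refine ⟨T, e, Finset.mem_insert_of_mem heD, ?_, heT, hTB, heTB⟩
      rw [Finset.coe_insert, Set.union_insert, ← Set.insert_union]
      exact hT

/-! ## The localised event is decided by the window -/

/-- Configurations agreeing on the window agree on `Aloc`. -/
theorem mem_Aloc_iff_of_inter_window_eq (m : ℕ) (F : Fin m → Quad (Set.univ : Set ℂ)) (η : ℝ)
    {ω ω' : BondConfig (Site 2)} (h : ω ∩ window m F η = ω' ∩ window m F η) :
    ω ∈ Aloc m F η ↔ ω' ∈ Aloc m F η := by
  show ω ∩ window m F η ∈ A m F η ↔ ω' ∩ window m F η ∈ A m F η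
  rw [h]

/-- The window consists of nearest-neighbour edges of `ℤ²`. -/
theorem mem_edgeSet_of_mem_window {m : ℕ} {F : Fin m → Quad (Set.univ : Set ℂ)} {η : ℝ}
    {e : Sym2 (Site 2)} (he : e ∈ window m F η) : e ∈ (zdGraph 2).edgeSet := by
  simp only [window, edgesNear, Set.mem_iUnion, Set.mem_inter_iff] at he
  obtain ⟨_, -, he⟩ := he
  exact he

/-- If `T ∉ Aloc`, `insert e T ∈ Aloc` and `e ∉ T`, then `e` is pivotal for `Aloc` at every
configuration agreeing with `T` on `window ∖ {e}`. -/
theorem localCylinder_subset_setOf_isPivotal (m : ℕ) (F : Fin m → Quad (Set.univ : Set ℂ))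
    (η : ℝ) {T : BondConfig (Site 2)} {e : Sym2 (Site 2)} (heT : e ∉ T) (hT : T ∉ Aloc m F η)
    (heT' : insert e T ∈ Aloc m F η) :
    localCylinder (window m F η \ {e}) T ⊆ {ω | IsPivotal (Aloc m F η) e ω} := by
  intro ω hω
  have h1 : insert e ω ∩ window m F η = insert e T ∩ window m F η := by
    ext i
    simp only [Set.mem_inter_iff, Set.mem_insert_iff]
    by_cases hie : i = e
    · simp only [hie, true_or, true_and]
    · constructor
      · rintro ⟨hi, hiw⟩
        exact ⟨Or.inr ((hω i ⟨hiw, hie⟩).1 (hi.resolve_left hie)), hiw⟩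
      · rintro ⟨hi, hiw⟩
        exact ⟨Or.inr ((hω i ⟨hiw, hie⟩).2 (hi.resolve_left hie)), hiw⟩
  have h2 : (ω \ {e}) ∩ window m F η = T ∩ window m F η := by
    ext i
    simp only [Set.mem_inter_iff, Set.mem_sdiff, Set.mem_singleton_iff]
    constructor
    · rintro ⟨⟨hi, hie⟩, hiw⟩
      exact ⟨(hω i ⟨hiw, hie⟩).1 hi, hiw⟩
    · rintro ⟨hi, hiw⟩
      have hie : i ≠ e := fun h => heT (h ▸ hi)
      exact ⟨⟨(hω i ⟨hiw, hie⟩).2 hi, hie⟩, hiw⟩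
  show IsPivotal (Aloc m F η) e ω
  unfold IsPivotal
  exact Or.inl ⟨(mem_Aloc_iff_of_inter_window_eq m F η h1).2 heT',
    fun h => hT ((mem_Aloc_iff_of_inter_window_eq m F η h2).1 h)⟩

/-- Under `P_{1/2}` a cylinder over finitely many lattice edges has positive probability
(namely `(½)^{|K|}`). -/
theorem bondPercolation_half_real_localCylinder_pos {K : Finset (Sym2 (Site 2))}
    (hK : (↑K : Set (Sym2 (Site 2))) ⊆ (zdGraph 2).edgeSet) (T : Set (Sym2 (Site 2))) :
    0 < (bondPercolation (zdGraph 2) half).real (localCylinder (↑K) T) := by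
  rw [bondPercolation, Russo.setBernoulli_real_localCylinder]
  refine Finset.prod_pos fun i hi => ?_
  have hiE : i ∈ (zdGraph 2).edgeSet := hK (Finset.mem_coe.2 hi)
  by_cases hiT : i ∈ T
  · simp only [Russo.weight, hiT, hiE, if_true, coe_half]
    norm_num
  · simp only [Russo.weight, hiT, hiE, if_true, if_false, coe_half]
    norm_num

/-! ## The stub -/

/-- **(D0) NON-DEGENERACY GIVES A PIVOTAL EDGE.**  If `0 < P_{1/2}(Aloc) (1 - P_{1/2}(Aloc))`, then
`0 < Σ_{e ∈ W} P_{1/2}(e pivotal for Aloc)²` for the window `W`: there are a configuration `T`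
and a window edge `e ∉ T` with `T ∉ Aloc`, `T ∪ {e} ∈ Aloc` (discrete intermediate value step
between a configuration outside `Aloc` and one inside, along the finite window which decides
`Aloc`), and then `e` is pivotal on the whole cylinder `[T]_{W ∖ {e}}`, of probability
`(½)^{|W|-1} > 0`. -/
theorem stub_exists_pivotal_of_nondegenerate (m : ℕ) (F : Fin m → Quad (Set.univ : Set ℂ)) {η : ℝ}
    (hη : η ≠ 0)
    (h : 0 < (bondPercolation (zdGraph 2) half).real (Aloc m F η) *
      (1 - (bondPercolation (zdGraph 2) half).real (Aloc m F η)))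
    (W : Finset (Sym2 (Site 2))) (hW : (↑W : Set (Sym2 (Site 2))) = window m F η) :
    0 < ∑ e ∈ W, (bondPercolation (zdGraph 2) half).real {ω | IsPivotal (Aloc m F η) e ω} ^ 2 := by
  classical
  -- `0 < t` and `0 < 1 - t`
  have ht : 0 < (bondPercolation (zdGraph 2) half).real (Aloc m F η) ∧
      0 < 1 - (bondPercolation (zdGraph 2) half).real (Aloc m F η) :=
    (pos_and_pos_or_neg_and_neg_of_mul_pos h).resolve_right
      fun h' => absurd h'.1 (not_lt.2 measureReal_nonneg)
  -- a configuration inside `Aloc` and one outside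
  obtain ⟨ω₀, hω₀⟩ : (Aloc m F η).Nonempty := nonempty_of_measureReal_ne_zero ht.1.ne'
  obtain ⟨ω₁, hω₁⟩ : (Aloc m F η)ᶜ.Nonempty := by
    refine nonempty_of_measureReal_ne_zero (μ := bondPercolation (zdGraph 2) half) ?_
    rw [probReal_compl_eq_one_sub (measurableSet_Aloc m F hη)]
    exact ht.2.ne'
  -- their traces on the window: `D ∈ Aloc`, `S ∉ Aloc`, `S ∪ D ∈ Aloc`
  have hD : (↑(W.filter (· ∈ ω₀)) : Set (Sym2 (Site 2))) ∈ Aloc m F η := by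
    refine (mem_Aloc_iff_of_inter_window_eq m F η ?_).2 hω₀
    ext i
    rw [← hW]
    simp only [Set.mem_inter_iff, Finset.mem_coe, Finset.mem_filter]
    tauto
  have hS : ω₁ ∩ ↑W ∉ Aloc m F η := by
    intro h'
    refine hω₁ ((mem_Aloc_iff_of_inter_window_eq m F η ?_).1 h')
    rw [← hW, Set.inter_assoc, Set.inter_self]
  have hSD : ω₁ ∩ ↑W ∪ ↑(W.filter (· ∈ ω₀)) ∈ Aloc m F η :=
    isUpperSet_Aloc m F η Set.subset_union_right hD
  -- the flip: `T ∉ Aloc`, `insert e T ∈ Aloc`, `e ∈ W`, `e ∉ T`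
  obtain ⟨T, e, heD, -, heT, hTB, heTB⟩ :=
    exists_insert_mem_of_union_mem (W.filter (· ∈ ω₀)) (ω₁ ∩ ↑W) hS hSD
  have heW : e ∈ W := (Finset.mem_filter.1 heD).1
  -- the cylinder `[T]_{W \ {e}}` consists of configurations at which `e` is pivotal
  have hsub : localCylinder (↑(W.erase e) : Set (Sym2 (Site 2))) T ⊆
      {ω | IsPivotal (Aloc m F η) e ω} := by
    rw [Finset.coe_erase, hW]
    exact localCylinder_subset_setOf_isPivotal m F η heT hTB heTB
  have hKE : (↑(W.erase e) : Set (Sym2 (Site 2))) ⊆ (zdGraph 2).edgeSet := by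
    intro x hx
    refine mem_edgeSet_of_mem_window (m := m) (F := F) (η := η) ?_
    rw [← hW]
    exact Finset.mem_coe.2 (Finset.mem_of_mem_erase (Finset.mem_coe.1 hx))
  have hpiv : 0 < (bondPercolation (zdGraph 2) half).real {ω | IsPivotal (Aloc m F η) e ω} :=
    (bondPercolation_half_real_localCylinder_pos hKE T).trans_le (measureReal_mono hsub)
  exact Finset.sum_pos' (fun i _ => sq_nonneg _) ⟨e, heW, pow_pos hpiv 2⟩

end Summit.CriticalPhenomena.CardyFormulaZ2.Theorems.CardySelfRefinement

end
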